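import Summits.CriticalPhenomena.PercolationContinuityZ3.Theorems.SoloBlindSparseFins

/-!
# Perforated walls: critical percolation on `ℤ³` does not pass through a sparsely perforated plane

Seat `solo-CriticalPhenomena-blind`.  For a pore set `M ⊆ ℤ²` let
`R_M = {0 ≤ x₀} ∪ {x₀ ≤ -2} ∪ {(-1, m) : m ∈ M}` — `ℤ³` minus the plane `{x₀ = -1}` perforated at
the pores.  `M ↦ R_M` is monotone, `R_{ℤ²} = ℤ³`, and for a co-singleton `M` the statement
`θ_{R_M}(p_c(ℤ³)) = 0` IS the summit (`ContinuityZ3Ladder.percolationContinuityZ3_iff_poreRegion_cosingleton`).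

* `theta_induce_poreRegion_criticalProbI_eq_zero` — if the pore tops `(0, m)`, `m ∈ M`, have
  summable pairwise connection probabilities inside `ℍ` at `p_c`, then `θ_{R_M}(x, p_c(ℤ³)) = 0` at
  every root (BGN on both sides + one-sided gluing + Borel–Cantelli; no planar or quantitative input);
* `theta_induce_poreRegion_criticalProbI_eq_zero_of_finite` — finitely many pores never let
  critical percolation through;
* `exists_infinite_poreRegion_theta_criticalProbI_eq_zero` — infinite such pore sets exist
  (`BoundaryDecay.exists_infinite_sparse_connectors`);
* `sparseFin_subset_poreRegion` — the sparse fins `S_Z` of `SoloBlindSparseFins` sit inside `R_{{0}×Z}`.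
-/

noncomputable section

namespace Summit.CriticalPhenomena.PercolationContinuityZ3.Theorems

open MeasureTheory Literature.Probability.Percolation Literature.Probability.LatticeModels
open Literature.Probability.Percolation.RegionGluing Literature.Probability.Percolation.BoundaryDecay

/-! ### Perforated walls

The same mechanism with the WHOLE lower half-space re-attached through a sparse set of pores:
for `M ⊆ ℤ²` let `R_M = {0 ≤ x₀} ∪ {x₀ ≤ -2} ∪ {(-1, m) : m ∈ M}` — this is `ℤ³` with the plane
`{x₀ = -1}` removed EXCEPT at the pore sites `(-1, m)`, `m ∈ M`.  Both regions `{0 ≤ x₀}` and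
`{x₀ ≤ -2} ∪ pores ⊆ {x₀ ≤ -1}` have only finite pieces at `p_c` (BGN), the cross edges are the
vertical edges `((0,m), (-1,m))` at the pores, and the one-sided criterion gives:
if `Σ_{m ≠ m' ∈ M} P_{p_c}((0,m) ↔ (0,m') in ℍ) < ∞` then `θ(p_c) = 0` at every root of `R_M`.
So critical percolation on `ℤ³` does not pass through a sparsely perforated plane; `M = ℤ²`
(no wall at all) is the summit itself, and `R_M` is monotone in `M`: the pore sets form a ladder
from this theorem (Borel–Cantelli-sparse `M`) to `θ(p_c) = 0` (cofinite `M`). -/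

/-- **Perforated walls, almost surely.** `P_{p_c}`-a.s., for every pore set `M ⊆ ℤ²`: if only
finitely many pore edges have a distinct partner pore edge in the same `ℍ`-piece, then every open
cluster computed inside `R_M` is finite. -/
theorem ae_poreRegion_openClusterIn_finite :
    ∀ᵐ ω ∂(bondPercolation (zdGraph 3) (criticalProbI 3)), ∀ M : Set (ℤ × ℤ),
      {e : Site 3 × Site 3 |
          (e.1 ∈ {x : Site 3 | 0 ≤ x 0} ∧
            e.2 ∈ {x : Site 3 | x 0 ≤ -2 ∨ (x 0 = -1 ∧ (x 1, x 2) ∈ M)} ∧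
            (zdGraph 3).Adj e.1 e.2) ∧
          ∃ e' : Site 3 × Site 3,
            (e'.1 ∈ {x : Site 3 | 0 ≤ x 0} ∧
              e'.2 ∈ {x : Site 3 | x 0 ≤ -2 ∨ (x 0 = -1 ∧ (x 1, x 2) ∈ M)} ∧
              (zdGraph 3).Adj e'.1 e'.2) ∧ e' ≠ e ∧
            e'.1 ∈ openClusterIn (withinGraph (zdGraph 3) {x : Site 3 | 0 ≤ x 0}) ω e.1}.Finite →
      ∀ x : Site 3, (openClusterIn (withinGraph (zdGraph 3)
          ({x : Site 3 | 0 ≤ x 0} ∪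
            {x : Site 3 | x 0 ≤ -2 ∨ (x 0 = -1 ∧ (x 1, x 2) ∈ M)})) ω x).Finite := by
  filter_upwards [ae_forall_not_percolatesVia_coordHalfSpace] with ω hH M hDA x
  have hAB : Disjoint ({x : Site 3 | 0 ≤ x 0})
      {x : Site 3 | x 0 ≤ -2 ∨ (x 0 = -1 ∧ (x 1, x 2) ∈ M)} := by
    rw [Set.disjoint_left]
    rintro v (hv : 0 ≤ v 0) (h | ⟨h, _⟩) <;> omega
  have hBle : {x : Site 3 | x 0 ≤ -2 ∨ (x 0 = -1 ∧ (x 1, x 2) ∈ M)} ⊆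
      {x : Site 3 | x 0 ≤ -1} := by
    rintro v (h | ⟨h, _⟩) <;> simp only [Set.mem_setOf_eq] <;> omega
  refine finite_openClusterIn_union hAB ?_ ?_ ?_ ?_ hDA x
  · intro u v v' hu hv hv' huv huv'
    have h1 := eq_add_single_of_zdGraph_adj_of_nonneg_of_le hu (hBle hv) huv
    have h2 := eq_add_single_of_zdGraph_adj_of_nonneg_of_le hu (hBle hv') huv'
    exact add_right_cancel (h1.symm.trans h2)
  · intro u u' v hu hu' hv huv hu'v
    have h1 := eq_add_single_of_zdGraph_adj_of_nonneg_of_le hu (hBle hv) huv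
    have h2 := eq_add_single_of_zdGraph_adj_of_nonneg_of_le hu' (hBle hv) hu'v
    exact h1.trans h2.symm
  · intro u
    exact Set.not_infinite.1 (hH 0 0 u).1
  · intro v
    refine Set.not_infinite.1 fun hinf => (hH 0 (-1) v).2 ?_
    exact hinf.mono (openClusterIn_mono_graph (withinGraph_mono _ hBle) ω v)

/-- The cross edges of `R_M` are exactly the pore edges `((0,m), (-1,m))`, `m ∈ M`. -/
theorem poreRegion_crossEdge_eq {M : Set (ℤ × ℤ)} {e : Site 3 × Site 3}
    (he : e.1 ∈ {x : Site 3 | 0 ≤ x 0} ∧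
      e.2 ∈ {x : Site 3 | x 0 ≤ -2 ∨ (x 0 = -1 ∧ (x 1, x 2) ∈ M)} ∧
      (zdGraph 3).Adj e.1 e.2) :
    (e.2 1, e.2 2) ∈ M ∧ e.1 = ![0, e.2 1, e.2 2] ∧ e.2 = ![-1, e.2 1, e.2 2] := by
  obtain ⟨h1, h2, hadj⟩ := he
  have h1' : 0 ≤ e.1 0 := h1
  have hle : e.2 0 ≤ -1 := by
    rcases h2 with h | ⟨h, _⟩
    · omega
    · omega
  have hmate := eq_add_single_of_zdGraph_adj_of_nonneg_of_le h1' hle hadj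
  have h0 : e.1 0 = e.2 0 + 1 := by
    have := congrArg (fun f : Site 3 => f 0) hmate
    simpa using this
  have hcoord : ∀ i, i ≠ (0 : Fin 3) → e.1 i = e.2 i := by
    intro i hi
    have := congrArg (fun f : Site 3 => f i) hmate
    simpa [Pi.single_eq_of_ne hi] using this
  rcases h2 with h | ⟨h20, hM⟩
  · exfalso; omega
  refine ⟨hM, ?_, ?_⟩
  · funext i
    match i with
    | 0 => show e.1 0 = 0; omega
    | 1 => exact hcoord 1 (by decide)
    | 2 => exact hcoord 2 (by decide)
  · funext i
    match i with
    | 0 => exact h20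
    | 1 => rfl
    | 2 => rfl

/-- **Critical percolation on `ℤ³` does not pass through a sparsely perforated plane.**  If the
pore tops `(0, m)`, `m ∈ M`, have summable pairwise connection probabilities inside `ℍ` at
`p_c(ℤ³)`, then `θ(p_c(ℤ³)) = 0` at every root of
`R_M = {0 ≤ x₀} ∪ {x₀ ≤ -2} ∪ {(-1, m) : m ∈ M}` = `ℤ³` minus the plane `{x₀ = -1}` perforated
at `M` (as an induced subgraph of `ℤ³`). -/
theorem theta_induce_poreRegion_criticalProbI_eq_zero (M : Set (ℤ × ℤ))
    (hA : ∑' q : {q : (ℤ × ℤ) × (ℤ × ℤ) // q.1 ∈ M ∧ q.2 ∈ M ∧ q.1 ≠ q.2},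
        (bondPercolation (zdGraph 3) (criticalProbI 3))
          (openConnVia (withinGraph (zdGraph 3) {x : Site 3 | 0 ≤ x 0})
            ![0, q.1.1.1, q.1.1.2] ![0, q.1.2.1, q.1.2.2]) ≠ ⊤)
    (x : Site 3)
    (hx : x ∈ {x : Site 3 | 0 ≤ x 0} ∪
      {x : Site 3 | x 0 ≤ -2 ∨ (x 0 = -1 ∧ (x 1, x 2) ∈ M)}) :
    theta ((zdGraph 3).induce ({x : Site 3 | 0 ≤ x 0} ∪
      {x : Site 3 | x 0 ≤ -2 ∨ (x 0 = -1 ∧ (x 1, x 2) ∈ M)})) ⟨x, hx⟩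
      (criticalProbI 3) = 0 := by
  rw [theta_induce_eq_real_percolatesVia]
  refine (measureReal_eq_zero_iff (measure_ne_top _ _)).2 (measure_eq_zero_iff_ae_notMem.2 ?_)
  filter_upwards [ae_poreRegion_openClusterIn_finite, MeasureTheory.ae_finite_setOf_mem hA]
    with ω hω hfA
  intro hperc
  refine hperc (hω M ?_ x)
  refine (hfA.image fun q : {q : (ℤ × ℤ) × (ℤ × ℤ) // q.1 ∈ M ∧ q.2 ∈ M ∧ q.1 ≠ q.2} =>
    (((![0, q.1.1.1, q.1.1.2] : Site 3), (![-1, q.1.1.1, q.1.1.2] : Site 3)) : Site 3 × Site 3)).subset ?_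
  rintro e ⟨he, e', he', hne, hconn⟩
  obtain ⟨hm, h1, h2⟩ := poreRegion_crossEdge_eq he
  obtain ⟨hm', h1', h2'⟩ := poreRegion_crossEdge_eq he'
  have hmm : (e.2 1, e.2 2) ≠ (e'.2 1, e'.2 2) := by
    intro h
    obtain ⟨ha, hb⟩ := Prod.mk.inj h
    apply hne
    refine Prod.ext ?_ ?_
    · rw [h1', h1, ha, hb]
    · rw [h2', h2, ha, hb]
  refine ⟨⟨((e.2 1, e.2 2), (e'.2 1, e'.2 2)), hm, hm', hmm⟩, ?_, ?_⟩
  · show (![0, e'.2 1, e'.2 2] : Site 3) ∈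
      openClusterIn _ ω (![0, e.2 1, e.2 2] : Site 3)
    rw [← h1, ← h1']; exact hconn
  · exact Prod.ext h1.symm h2.symm

/-- **Finitely many pores never let critical percolation through** (the bottom of the pore
ladder): for finite `M` the summability hypothesis is automatic. -/
theorem theta_induce_poreRegion_criticalProbI_eq_zero_of_finite {M : Set (ℤ × ℤ)}
    (hM : M.Finite) (x : Site 3)
    (hx : x ∈ {x : Site 3 | 0 ≤ x 0} ∪
      {x : Site 3 | x 0 ≤ -2 ∨ (x 0 = -1 ∧ (x 1, x 2) ∈ M)}) :
    theta ((zdGraph 3).induce ({x : Site 3 | 0 ≤ x 0} ∪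
      {x : Site 3 | x 0 ≤ -2 ∨ (x 0 = -1 ∧ (x 1, x 2) ∈ M)})) ⟨x, hx⟩
      (criticalProbI 3) = 0 := by
  refine theta_induce_poreRegion_criticalProbI_eq_zero M ?_ x hx
  have hfin : {q : (ℤ × ℤ) × (ℤ × ℤ) | q.1 ∈ M ∧ q.2 ∈ M ∧ q.1 ≠ q.2}.Finite :=
    (hM.prod hM).subset fun q hq => ⟨hq.1, hq.2.1⟩
  haveI : Finite {q : (ℤ × ℤ) × (ℤ × ℤ) // q.1 ∈ M ∧ q.2 ∈ M ∧ q.1 ≠ q.2} := hfin.to_subtype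
  haveI : Fintype {q : (ℤ × ℤ) × (ℤ × ℤ) // q.1 ∈ M ∧ q.2 ∈ M ∧ q.1 ≠ q.2} := Fintype.ofFinite _
  rw [tsum_fintype]
  exact ENNReal.sum_ne_top.2 fun _ _ => measure_ne_top _ _

/-- `(0, 0, z)` in the two coordinate descriptions used in this file. -/
theorem vec3_zero_zero_eq_update (z : ℤ) :
    (![0, 0, z] : Site 3) = Function.update (0 : Site 3) 2 z := by
  funext i
  match i with
  | 0 => rw [Function.update_of_ne (by decide)]; rfl
  | 1 => rw [Function.update_of_ne (by decide)]; rfl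
  | 2 => rw [Function.update_self]; rfl

/-- **Infinite sparsely perforated walls exist (unconditional).** There is an infinite pore set
`M ⊆ ℤ²` (pores along a line, with fast-growing gaps) such that `ℤ³` minus the plane `{x₀ = -1}`
perforated at `M` has `θ(p_c(ℤ³)) = 0` at every root. -/
theorem exists_infinite_poreRegion_theta_criticalProbI_eq_zero :
    ∃ M : Set (ℤ × ℤ), M.Infinite ∧ ∀ (x : Site 3)
      (hx : x ∈ {x : Site 3 | 0 ≤ x 0} ∪
        {x : Site 3 | x 0 ≤ -2 ∨ (x 0 = -1 ∧ (x 1, x 2) ∈ M)}),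
      theta ((zdGraph 3).induce ({x : Site 3 | 0 ≤ x 0} ∪
        {x : Site 3 | x 0 ≤ -2 ∨ (x 0 = -1 ∧ (x 1, x 2) ∈ M)})) ⟨x, hx⟩
        (criticalProbI 3) = 0 := by
  obtain ⟨Z, hZ, hsum⟩ := exists_infinite_sparse_connectors
  refine ⟨{m : ℤ × ℤ | m.1 = 0 ∧ m.2 ∈ Z}, ?_, fun x hx =>
    theta_induce_poreRegion_criticalProbI_eq_zero _ ?_ x hx⟩
  · haveI := hZ.to_subtype
    exact Set.infinite_of_injective_forall_mem (f := fun z : Z => ((0 : ℤ), (z : ℤ)))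
      (fun a b h => Subtype.ext (Prod.mk.inj h).2) (fun z => ⟨rfl, z.2⟩)
  · -- transport the pair sum along `(0, z) ↦ z`
    have hφ : ∀ q : {q : (ℤ × ℤ) × (ℤ × ℤ) //
        q.1 ∈ {m : ℤ × ℤ | m.1 = 0 ∧ m.2 ∈ Z} ∧ q.2 ∈ {m : ℤ × ℤ | m.1 = 0 ∧ m.2 ∈ Z} ∧ q.1 ≠ q.2},
        q.1.1.2 ∈ Z ∧ q.1.2.2 ∈ Z ∧ q.1.1.2 ≠ q.1.2.2 := by
      rintro ⟨⟨m, m'⟩, ⟨hm0, hmZ⟩, ⟨hm0', hmZ'⟩, hne⟩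
      refine ⟨hmZ, hmZ', fun h => hne (Prod.ext (hm0.trans hm0'.symm) h)⟩
    let φ : {q : (ℤ × ℤ) × (ℤ × ℤ) //
        q.1 ∈ {m : ℤ × ℤ | m.1 = 0 ∧ m.2 ∈ Z} ∧ q.2 ∈ {m : ℤ × ℤ | m.1 = 0 ∧ m.2 ∈ Z} ∧ q.1 ≠ q.2} →
        {q : ℤ × ℤ // q.1 ∈ Z ∧ q.2 ∈ Z ∧ q.1 ≠ q.2} :=
      fun q => ⟨(q.1.1.2, q.1.2.2), hφ q⟩
    have hφinj : Function.Injective φ := by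
      rintro ⟨⟨m, m'⟩, ⟨hm0, _⟩, ⟨hm0', _⟩, _⟩ ⟨⟨n, n'⟩, ⟨hn0, _⟩, ⟨hn0', _⟩, _⟩ h
      have h' := congrArg Subtype.val h
      simp only [φ, Prod.mk.injEq] at h'
      dsimp only at hm0 hm0' hn0 hn0'
      apply Subtype.ext
      show (m, m') = (n, n')
      rw [Prod.mk.injEq]
      exact ⟨Prod.ext (hm0.trans hn0.symm) h'.1, Prod.ext (hm0'.trans hn0'.symm) h'.2⟩
    refine ne_top_of_le_ne_top hsum ?_
    calc ∑' q : {q : (ℤ × ℤ) × (ℤ × ℤ) //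
          q.1 ∈ {m : ℤ × ℤ | m.1 = 0 ∧ m.2 ∈ Z} ∧ q.2 ∈ {m : ℤ × ℤ | m.1 = 0 ∧ m.2 ∈ Z} ∧ q.1 ≠ q.2},
          (bondPercolation (zdGraph 3) (criticalProbI 3))
            (openConnVia (withinGraph (zdGraph 3) {x : Site 3 | 0 ≤ x 0})
              ![0, q.1.1.1, q.1.1.2] ![0, q.1.2.1, q.1.2.2])
        = ∑' q : {q : (ℤ × ℤ) × (ℤ × ℤ) //
          q.1 ∈ {m : ℤ × ℤ | m.1 = 0 ∧ m.2 ∈ Z} ∧ q.2 ∈ {m : ℤ × ℤ | m.1 = 0 ∧ m.2 ∈ Z} ∧ q.1 ≠ q.2},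
          (fun q' : {q : ℤ × ℤ // q.1 ∈ Z ∧ q.2 ∈ Z ∧ q.1 ≠ q.2} =>
            (bondPercolation (zdGraph 3) (criticalProbI 3))
              (openConnVia (withinGraph (zdGraph 3) {x : Site 3 | 0 ≤ x 0})
                (Function.update (0 : Site 3) 2 q'.1.1) (Function.update (0 : Site 3) 2 q'.1.2)))
            (φ q) := by
          refine tsum_congr ?_
          rintro ⟨⟨m, m'⟩, ⟨hm0, hmZ⟩, ⟨hm0', hmZ'⟩, hne⟩
          show (bondPercolation (zdGraph 3) (criticalProbI 3))
              (openConnVia (withinGraph (zdGraph 3) {x : Site 3 | 0 ≤ x 0})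
                ![0, m.1, m.2] ![0, m'.1, m'.2]) =
            (bondPercolation (zdGraph 3) (criticalProbI 3))
              (openConnVia (withinGraph (zdGraph 3) {x : Site 3 | 0 ≤ x 0})
                (Function.update (0 : Site 3) 2 m.2) (Function.update (0 : Site 3) 2 m'.2))
          rw [hm0, hm0', vec3_zero_zero_eq_update, vec3_zero_zero_eq_update]
      _ ≤ _ := ENNReal.tsum_comp_le_tsum_of_injective hφinj _

/-- The sparse-fin regions sit inside the corresponding pore regions (pores `{0} × Z`), so the
perforated-wall theorem contains the sparse-fin theorem (by `theta_induce_mono`). -/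
theorem sparseFin_subset_poreRegion (Z : Set ℤ) :
    ({x : Site 3 | 0 ≤ x 0} ∪
        {x : Site 3 | (x 1 = 0 ∧ x 0 ≤ -2) ∨ (x 1 = 0 ∧ x 0 = -1 ∧ x 2 ∈ Z)}) ⊆
      ({x : Site 3 | 0 ≤ x 0} ∪
        {x : Site 3 | x 0 ≤ -2 ∨ (x 0 = -1 ∧ (x 1, x 2) ∈ {m : ℤ × ℤ | m.1 = 0 ∧ m.2 ∈ Z})}) := by
  rintro x (hx | ⟨h1, h0⟩ | ⟨h1, h0, hZ⟩)
  · exact Or.inl hx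
  · exact Or.inr (Or.inl h0)
  · exact Or.inr (Or.inr ⟨h0, h1, hZ⟩)


end Summit.CriticalPhenomena.PercolationContinuityZ3.Theorems
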